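import Literature.NumberTheory.Transcendental.KZDilationLogSector
import Literature.NumberTheory.Transcendental.SemialgebraicRpow
import Literature.NumberTheory.Transcendental.SemialgebraicLineDeriv
import Literature.NumberTheory.Transcendental.SemialgebraicDslope
import Literature.NumberTheory.Transcendental.KZSemialgebraicComplex
import HarnessLib

/-!
# The logarithmic sector of the Kontsevich–Zagier dilation pencil, III: logarithmic generators
with real algebraic poles, and one-dimensional dilation integrals of derivatives

Setting of `KZDilationLogSector.lean` (`(a, b) ⊇ [0,1]`, dilation functions
`v_h(ϖ) = ∫_{[0,1]¹} h(ϖ z) dz`). This file supplies the calculus of the GENERATORS of the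
logarithmic sector with real algebraic poles,
  `Q_N(x) = Π_k (1 − x/α_k)^{N_k}`  (`α_k ∉ (a,b)` real algebraic, `N_k ∈ ℚ`),
positive Nash functions on `(a,b)` with `Q_N'/Q_N = Σ_k N_k/(x − α_k)` and `Q_N(0) = 1`,
`Q_N(1) = exp(Σ_k N_k log(1 − 1/α_k))` (`prod_rpow_*`, `isSemialgebraicFunOn_prod_rpow`), together
with two generic facts on one-dimensional dilation integrals: `∫_{[0,1]¹} g(ϖz) dz = (Φ(ϖ) − Φ(0))/ϖ`
for a primitive `Φ` of `g` (`dilation_integral_of_hasDerivAt`) and `v_{ρ'} = dslope ρ 0` for `ρ`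
real-analytic (`dilation_integral_deriv`), plus integrability of dilated continuous functions on
`[0,1]¹`. These are the inputs of the Baker-sector lift of the dilation lifting problem
(route `KontsevichZagierPeriods/LiftingCriteria`, crux `DilationLiftAtOne`): by Baker's theorem a
vanishing combination `Σ_k c_k log(1 − 1/α_k) + r = 0` decomposes along rational exact relations
`N`, for which `Q_N(1) = Q_N(0)` and `KZ.dilationLogSector_lift` applies.

Everything is proved; no `def`, no named fact.

## References
* M. Kontsevich, D. Zagier, *Periods* (2001), §1.2. [`KontsevichZagier2001`]
* J. Bochnak, M. Coste, M.-F. Roy, *Real Algebraic Geometry* (1998), Prop. 2.2.6. [`BochnakCosteRoy1998`]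
-/

noncomputable section

open Set MeasureTheory Filter MvPolynomial
open scoped BigOperators Topology
open Literature.ModelTheory.ExponentialFields

namespace Literature.NumberTheory.Transcendental

namespace KZ.DilationLogSector

/-! ### One-dimensional dilation integrals -/

/-- **Dilation function of a derivative, `ϖ ∈ (0,1]`.** If `Φ' = g` on `(a,b) ⊇ [0,1]` and `g` is
continuous there, then `∫_{[0,1]¹} g(ϖ z) dz = (Φ(ϖ) − Φ(0))/ϖ` (fundamental theorem of calculus
for `y ↦ Φ(ϖy)/ϖ`). [cite: KontsevichZagier2001, §1.2] -/
theorem dilation_integral_of_hasDerivAt {a b : ℝ} (ha : a < 0) (hb : 1 < b) {Φ g : ℝ → ℝ}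
    (hder : ∀ x ∈ Ioo a b, HasDerivAt Φ (g x) x) (hg : ContinuousOn g (Ioo a b))
    {ϖ : ℝ} (hϖ : ϖ ∈ Ioc (0:ℝ) 1) :
    (∫ z in Set.pi Set.univ (fun _ : Fin 1 => Icc (0:ℝ) 1), g ((ϖ • z) 0)) = (Φ ϖ - Φ 0) / ϖ := by
  have hϖ0 : ϖ ≠ 0 := hϖ.1.ne'
  have hmem : ∀ y ∈ Icc (0:ℝ) 1, ϖ * y ∈ Ioo a b := fun y hy =>
    ⟨lt_of_lt_of_le ha (mul_nonneg hϖ.1.le hy.1), lt_of_le_of_lt (mul_le_one₀ hϖ.2 hy.1 hy.2) hb⟩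
  have key : (∫ z in Set.pi Set.univ (fun _ : Fin 1 => Icc (0:ℝ) 1), g ((ϖ • z) 0)) =
      ∫ t in Icc (0:ℝ) 1, g (ϖ * t) := by
    simp only [Pi.smul_apply, smul_eq_mul]
    exact setIntegral_cube_one (fun t => g (ϖ * t))
  rw [key, integral_Icc_eq_integral_Ioc, ← intervalIntegral.integral_of_le zero_le_one]
  have hderiv : ∀ y ∈ uIcc (0:ℝ) 1, HasDerivAt (fun y => Φ (ϖ * y) / ϖ) (g (ϖ * y)) y := by
    intro y hy
    rw [uIcc_of_le zero_le_one] at hy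
    have h1 : HasDerivAt (fun y => ϖ * y) ϖ y := by simpa using (hasDerivAt_id y).const_mul ϖ
    have h2 : HasDerivAt (fun y => Φ (ϖ * y)) (g (ϖ * y) * ϖ) y := (hder _ (hmem y hy)).comp y h1
    have h3 := h2.div_const ϖ
    rw [mul_div_assoc, div_self hϖ0, mul_one] at h3
    exact h3
  rw [intervalIntegral.integral_eq_sub_of_hasDerivAt hderiv]
  · simp only [mul_one, mul_zero]
    ring
  · apply ContinuousOn.intervalIntegrable
    rw [uIcc_of_le zero_le_one]
    exact hg.comp (by fun_prop) hmem

/-- **Dilation function of the derivative of a Nash function.** For `ρ` real-analytic on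
`(a,b) ⊇ [0,1]` and `ϖ ∈ [0,1]`: `∫_{[0,1]¹} ρ'(ϖ z) dz = dslope ρ 0 ϖ` (`= (ρ(ϖ) − ρ(0))/ϖ` for
`ϖ ≠ 0`, `= ρ'(0)` at `ϖ = 0`). [cite: KontsevichZagier2001, §1.2] -/
theorem dilation_integral_deriv {a b : ℝ} (ha : a < 0) (hb : 1 < b) {ρ : ℝ → ℝ}
    (hρa : ∀ x ∈ Ioo a b, AnalyticAt ℝ ρ x) {ϖ : ℝ} (hϖ : ϖ ∈ Icc (0:ℝ) 1) :
    (∫ z in Set.pi Set.univ (fun _ : Fin 1 => Icc (0:ℝ) 1), deriv ρ ((ϖ • z) 0)) = dslope ρ 0 ϖ := by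
  rcases hϖ.1.eq_or_lt with h0 | hpos
  · rw [← h0, dslope_same]
    exact dilation_integral_zero
  · have hder : ∀ x ∈ Ioo a b, HasDerivAt ρ (deriv ρ x) x := fun x hx =>
      (hρa x hx).differentiableAt.hasDerivAt
    have hcont : ContinuousOn (deriv ρ) (Ioo a b) := fun x hx =>
      (hρa x hx).deriv.continuousAt.continuousWithinAt
    rw [dilation_integral_of_hasDerivAt ha hb hder hcont ⟨hpos, hϖ.2⟩,
      dslope_of_ne _ hpos.ne', slope_def_field, sub_zero]

/-- A dilated continuous function is integrable on `[0,1]¹`. [folklore] -/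
theorem integrableOn_dilate_one {a b : ℝ} (ha : a < 0) (hb : 1 < b) {F : ℝ → ℝ}
    (hF : ContinuousOn F (Ioo a b)) {ϖ : ℝ} (hϖ : ϖ ∈ Icc (0:ℝ) 1) :
    IntegrableOn (fun z : Fin 1 → ℝ => F ((ϖ • z) 0))
      (Set.pi Set.univ (fun _ : Fin 1 => Icc (0:ℝ) 1)) volume := by
  refine ContinuousOn.integrableOn_compact (isCompact_univ_pi fun _ => isCompact_Icc) ?_
  have hpath : Continuous fun z : Fin 1 → ℝ => (ϖ • z) 0 := by fun_prop
  refine hF.comp hpath.continuousOn fun z hz => ?_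
  have hz0 : z 0 ∈ Icc (0:ℝ) 1 := (Set.mem_univ_pi.mp hz) 0
  simp only [Pi.smul_apply, smul_eq_mul]
  exact ⟨lt_of_lt_of_le ha (mul_nonneg hϖ.1 hz0.1), lt_of_le_of_lt (mul_le_one₀ hϖ.2 hz0.1 hz0.2) hb⟩

/-- `∫_{[0,1]¹} c dy = c` (the cube `[0,1]¹` has volume one). [folklore] -/
theorem setIntegral_cube_one_const (c : ℝ) :
    (∫ _y in Set.pi Set.univ (fun _ : Fin 1 => Icc (0:ℝ) 1), c) = c := by
  rw [setIntegral_cube_one (fun _ => c), setIntegral_const]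
  simp

/-! ### The logarithmic generators `Q_N = Π_k (1 − x/α_k)^{N_k}` -/

section LogGenerators

variable {a b : ℝ} {A : ℕ} {α : Fin A → ℝ}

/-- Positivity of the bases: for `α ∉ (a,b)` (i.e. `α ≤ a` or `b ≤ α`, with `a < 0 < b`) and
`x ∈ (a,b)`, `0 < 1 − x/α`. [folklore] -/
theorem one_sub_div_pos (ha : a < 0) (hb : 0 < b) (hα : ∀ k, α k ≤ a ∨ b ≤ α k) (k : Fin A) {x : ℝ}
    (hx : x ∈ Ioo a b) : 0 < 1 - x / α k := by
  rcases hα k with h | h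
  · have hαneg : α k < 0 := lt_of_le_of_lt h ha
    have : x / α k < 1 := by
      rw [div_lt_one_of_neg hαneg]; exact lt_of_le_of_lt h hx.1
    linarith
  · have hαpos : 0 < α k := lt_of_lt_of_le hb h
    have : x / α k < 1 := by
      rw [div_lt_one hαpos]; exact lt_of_lt_of_le hx.2 h
    linarith

/-- The poles are non-zero: `α k ≠ 0`. [folklore] -/
theorem pole_ne_zero (ha : a < 0) (hb : 0 < b) (hα : ∀ k, α k ≤ a ∨ b ≤ α k) (k : Fin A) :
    α k ≠ 0 := by
  rcases hα k with h | h
  · exact (lt_of_le_of_lt h ha).ne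
  · exact (lt_of_lt_of_le hb h).ne'

/-- `d/dx log(1 − x/α) = 1/(x − α)` on `(a,b)`. [folklore] -/
theorem hasDerivAt_log_one_sub_div (ha : a < 0) (hb : 0 < b) (hα : ∀ k, α k ≤ a ∨ b ≤ α k) (k : Fin A)
    {x : ℝ} (hx : x ∈ Ioo a b) :
    HasDerivAt (fun x => Real.log (1 - x / α k)) (1 / (x - α k)) x := by
  have hαk := pole_ne_zero ha hb hα k
  have hb0 := one_sub_div_pos ha hb hα k hx
  have h1 : HasDerivAt (fun x => 1 - x / α k) (-(α k)⁻¹) x := by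
    simpa [div_eq_mul_inv] using ((hasDerivAt_id x).mul_const (α k)⁻¹).const_sub 1
  have h2 := h1.log hb0.ne'
  convert h2 using 1
  have hxα : x - α k ≠ 0 := by
    intro h
    have : 1 - x / α k = 0 := by rw [sub_eq_zero] at h; rw [h, div_self hαk, sub_self]
    exact hb0.ne' this
  have hxα' : -x + α k ≠ 0 := fun h => hxα (by linarith)
  have hxα'' : α k - x ≠ 0 := fun h => hxα (by linarith)
  field_simp
  ring

/-- On `(a,b)`: `Q_N(x) := Π_k (1 − x/α_k)^{N_k} = exp(Σ_k N_k log(1 − x/α_k))`. [folklore] -/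
theorem prod_rpow_eq_exp (ha : a < 0) (hb : 0 < b) (hα : ∀ k, α k ≤ a ∨ b ≤ α k) (N : Fin A → ℚ)
    {x : ℝ} (hx : x ∈ Ioo a b) :
    (∏ k, (1 - x / α k) ^ ((N k : ℚ) : ℝ)) = Real.exp (∑ k, (N k : ℝ) * Real.log (1 - x / α k)) := by
  rw [Real.exp_sum]
  refine Finset.prod_congr rfl fun k _ => ?_
  rw [Real.rpow_def_of_pos (one_sub_div_pos ha hb hα k hx), mul_comm]

/-- `Q_N > 0` on `(a,b)`. [folklore] -/
theorem prod_rpow_pos (ha : a < 0) (hb : 0 < b) (hα : ∀ k, α k ≤ a ∨ b ≤ α k) (N : Fin A → ℚ)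
    {x : ℝ} (hx : x ∈ Ioo a b) : 0 < (∏ k, (1 - x / α k) ^ ((N k : ℚ) : ℝ)) := by
  rw [prod_rpow_eq_exp ha hb hα N hx]; exact Real.exp_pos _

/-- `Q_N' = (Σ_k N_k/(x − α_k)) · Q_N` on `(a,b)` (logarithmic derivative of the product).
[folklore] -/
theorem hasDerivAt_prod_rpow (ha : a < 0) (hb : 0 < b) (hα : ∀ k, α k ≤ a ∨ b ≤ α k) (N : Fin A → ℚ)
    {x : ℝ} (hx : x ∈ Ioo a b) :
    HasDerivAt (fun x => ∏ k, (1 - x / α k) ^ ((N k : ℚ) : ℝ)) ((∑ k, (N k : ℝ) / (x - α k)) * (∏ k, (1 - x / α k) ^ ((N k : ℚ) : ℝ))) x := by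
  have hE : ∀ y ∈ Ioo a b, (∏ k, (1 - y / α k) ^ ((N k : ℚ) : ℝ)) = Real.exp (∑ k, (N k : ℝ) * Real.log (1 - y / α k)) :=
    fun y hy => prod_rpow_eq_exp ha hb hα N hy
  have hsum : HasDerivAt (fun y => ∑ k, (N k : ℝ) * Real.log (1 - y / α k))
      (∑ k, (N k : ℝ) * (1 / (x - α k))) x :=
    HasDerivAt.fun_sum fun k _ => (hasDerivAt_log_one_sub_div ha hb hα k hx).const_mul _
  have hexp := hsum.exp
  have heq : (fun y => Real.exp (∑ k, (N k : ℝ) * Real.log (1 - y / α k))) =ᶠ[𝓝 x]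
      (fun x => ∏ k, (1 - x / α k) ^ ((N k : ℚ) : ℝ)) := by
    filter_upwards [Ioo_mem_nhds hx.1 hx.2] with y hy
    exact (hE y hy).symm
  refine (hexp.congr_of_eventuallyEq heq.symm).congr_deriv ?_
  rw [hE x hx, mul_comm]
  congr 1
  exact Finset.sum_congr rfl fun k _ => by rw [mul_one_div]

/-- `Q_N` is real-analytic on `(a,b)`. [folklore] -/
theorem analyticAt_prod_rpow (ha : a < 0) (hb : 0 < b) (hα : ∀ k, α k ≤ a ∨ b ≤ α k) (N : Fin A → ℚ)
    {x : ℝ} (hx : x ∈ Ioo a b) : AnalyticAt ℝ (fun x => ∏ k, (1 - x / α k) ^ ((N k : ℚ) : ℝ)) x := by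
  have heq : (fun y => Real.exp (∑ k, (N k : ℝ) * Real.log (1 - y / α k))) =ᶠ[𝓝 x]
      (fun x => ∏ k, (1 - x / α k) ^ ((N k : ℚ) : ℝ)) := by
    filter_upwards [Ioo_mem_nhds hx.1 hx.2] with y hy
    exact (prod_rpow_eq_exp ha hb hα N hy).symm
  refine AnalyticAt.congr ?_ heq
  refine AnalyticAt.comp (g := Real.exp) analyticAt_rexp ?_
  refine Finset.analyticAt_fun_sum _ fun k _ => ?_
  refine analyticAt_const.mul ?_
  refine AnalyticAt.comp (g := Real.log) (analyticAt_log (one_sub_div_pos ha hb hα k hx)) ?_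
  exact analyticAt_const.sub (analyticAt_id.div analyticAt_const (pole_ne_zero ha hb hα k))

/-- `Q_N(0) = 1`. [folklore] -/
theorem prod_rpow_zero (N : Fin A → ℚ) : (∏ k, (1 - (0:ℝ) / α k) ^ ((N k : ℚ) : ℝ)) = 1 := by
  simp

/-- `Q_N(1) = exp(Σ_k N_k log(1 − 1/α_k))`; in particular `Q_N(1) = 1` for an exact relation
`Σ_k N_k log(1 − 1/α_k) = 0`. [folklore] -/
theorem prod_rpow_one (ha : a < 0) (hb : 1 < b) (hα : ∀ k, α k ≤ a ∨ b ≤ α k) (N : Fin A → ℚ)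
    (hrel : ∑ k, (N k : ℝ) * Real.log (1 - 1 / α k) = 0) : (∏ k, (1 - (1:ℝ) / α k) ^ ((N k : ℚ) : ℝ)) = 1 := by
  have h1 : (1:ℝ) ∈ Ioo a b := ⟨ha.trans zero_lt_one, hb⟩
  rw [prod_rpow_eq_exp ha (zero_lt_one.trans hb) hα N h1, hrel, Real.exp_zero]

/-- `Q_N` is `ℚ`-semialgebraic on `(a,b)` (products of rational powers of the positive affine
functions `1 − x/α_k` with algebraic `α_k`). [cite: BochnakCosteRoy1998, Prop. 2.2.6] -/
theorem isSemialgebraicFunOn_prod_rpow (ha : a < 0) (hb : 0 < b) (hα : ∀ k, α k ≤ a ∨ b ≤ α k)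
    (hαalg : ∀ k, IsAlgebraic ℚ (α k)) (hI : IsSemialgebraic ℚ {t : Fin 1 → ℝ | t 0 ∈ Ioo a b})
    (N : Fin A → ℚ) :
    IsSemialgebraicFunOn ℚ {t : Fin 1 → ℝ | t 0 ∈ Ioo a b} (fun t => (∏ k, (1 - t 0 / α k) ^ ((N k : ℚ) : ℝ))) := by
  have hbase : ∀ k, IsSemialgebraicFunOn ℚ {t : Fin 1 → ℝ | t 0 ∈ Ioo a b}
      (fun t => 1 - t 0 / α k) := fun k => by
    have hc : IsSemialgebraicFunOn ℚ {t : Fin 1 → ℝ | t 0 ∈ Ioo a b} (fun _ => -(α k)⁻¹) :=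
      isSemialgebraicFunOn_const_of_isAlgebraic hI (hαalg k).inv.neg
    have hx : IsSemialgebraicFunOn ℚ {t : Fin 1 → ℝ | t 0 ∈ Ioo a b} (fun t => t 0) := by
      simpa using isSemialgebraicFunOn_aeval hI (X 0 : MvPolynomial (Fin 1) ℚ)
    have h1 : IsSemialgebraicFunOn ℚ {t : Fin 1 → ℝ | t 0 ∈ Ioo a b} (fun _ => (1:ℝ)) := by
      simpa using isSemialgebraicFunOn_const_natCast hI 1
    exact (h1.fun_add (hc.fun_mul hx)).congr fun t _ => by ring
  exact IsSemialgebraicFunOn.finset_prod hI Finset.univ fun k _ =>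
    (hbase k).rpow_ratCast hI (fun t ht => one_sub_div_pos ha hb hα k ht) (N k)

end LogGenerators

end KZ.DilationLogSector

end Literature.NumberTheory.Transcendental
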